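import Summits.AtomisticToContinuum.HydrodynamicLimit.Theorems.RelayRaceLocalityLightConeInLawSketchLine

/-!
# Stub `flux_dot_le` of the line `Sketch` for the crux `LightConeInLaw` (DoD leg)
(stmt-AtomisticToContinuum-12500; route `RelayRaceLocality`, sub-problem `HydrodynamicLimit`)

Pointwise FLUX DOMINATION `|ν · Φ| ≤ ‖ν‖ s e` of the cone-weighted relative-energy method
(finite domain of dependence for classical hard-sphere Euler solutions; Dafermos 2005,
Thm 5.2.1, inequality (5.2.5)), written in coordinates on `Fin 3`: with the symmetrised energy
`e = ½ (A α² + r ∑ⱼ wⱼ² + B β²)` (`A, r, B ≥ 0`) of the difference of two solutions and the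
flux components `Φᵢ = ½ uᵢ (A α² + r ∑ⱼ wⱼ² + B β²) + P α wᵢ + R β wᵢ`, where
`P² ≤ S₁² A r` and `R² ≤ S₂² B r` (`S₁, S₂ ≥ 0`), one has
`|∑ᵢ νᵢ Φᵢ| ≤ ‖ν‖ (‖u‖ + S₁ + S₂) e` for every `ν`.

Proof (elementary real algebra): `∑ᵢ νᵢ Φᵢ = e (ν · u) + (P α + R β) (ν · w)`;
Cauchy–Schwarz on `Fin 3` gives `|ν · u| ≤ ‖ν‖ ‖u‖` and `|ν · w| ≤ ‖ν‖ ‖w‖`; and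
`|P| |α| ‖w‖ ≤ S₁ e`, `|R| |β| ‖w‖ ≤ S₂ e` by squaring both sides and `4 x y ≤ (x + y)²`
(each partial sum of the three nonnegative terms of `2 e` is at most `2 e`).
-/

namespace Summit.AtomisticToContinuum.HydrodynamicLimit.Theorems.LightConeInLawSketch.DoD

open scoped BigOperators Topology Classical ENNReal
open Filter Set MeasureTheory
open Literature.MathematicalPhysics.KineticTheory Literature.Analysis.FluidPDE
  Literature.Analysis.FunctionSpaces

noncomputable section

/-- Cauchy–Schwarz on a finset, absolute-value form: `|∑ fᵢ gᵢ| ≤ √(∑ fᵢ²) · √(∑ gᵢ²)`. -/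
theorem abs_sum_mul_le_sqrt_mul_sqrt {ι : Type*} (s : Finset ι) (f g : ι → ℝ) :
    |∑ i ∈ s, f i * g i| ≤ Real.sqrt (∑ i ∈ s, f i ^ 2) * Real.sqrt (∑ i ∈ s, g i ^ 2) := by
  rw [← Real.sqrt_mul (Finset.sum_nonneg fun i _ => sq_nonneg (f i))]
  exact Real.abs_le_sqrt (Finset.sum_mul_sq_le_sq_mul_sq s f g)

/-- The mixed-term bound of the flux domination: if `P² ≤ S² (A r)` with `S, A, r, W ≥ 0` and
`A α² + r W ≤ 2 e`, then `|P| |α| √W ≤ S e` (square both sides and use `4 x y ≤ (x + y)²`). -/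
theorem abs_mul_abs_mul_sqrt_le {P S A r al W e : ℝ} (hS : 0 ≤ S) (hA : 0 ≤ A) (hr : 0 ≤ r)
    (hW : 0 ≤ W) (hP : P ^ 2 ≤ S ^ 2 * (A * r)) (he : A * al ^ 2 + r * W ≤ 2 * e) :
    |P| * |al| * Real.sqrt W ≤ S * e := by
  have hx : 0 ≤ A * al ^ 2 := mul_nonneg hA (sq_nonneg _)
  have hy : 0 ≤ r * W := mul_nonneg hr hW
  have he0 : 0 ≤ e := by linarith
  refine (sq_le_sq₀ (by positivity) (mul_nonneg hS he0)).1 ?_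
  have hsq : (|P| * |al| * Real.sqrt W) ^ 2 = P ^ 2 * (al ^ 2 * W) := by
    rw [mul_pow, mul_pow, sq_abs, sq_abs, Real.sq_sqrt hW, mul_assoc]
  have h1 : P ^ 2 * (al ^ 2 * W) ≤ S ^ 2 * (A * r) * (al ^ 2 * W) :=
    mul_le_mul_of_nonneg_right hP (mul_nonneg (sq_nonneg _) hW)
  have h2 : A * r * (al ^ 2 * W) ≤ e ^ 2 := by
    have h3 : (A * al ^ 2 + r * W) ^ 2 ≤ (2 * e) ^ 2 := pow_le_pow_left₀ (add_nonneg hx hy) he 2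
    nlinarith [sq_nonneg (A * al ^ 2 - r * W)]
  calc (|P| * |al| * Real.sqrt W) ^ 2 = P ^ 2 * (al ^ 2 * W) := hsq
    _ ≤ S ^ 2 * (A * r) * (al ^ 2 * W) := h1
    _ = S ^ 2 * (A * r * (al ^ 2 * W)) := by ring
    _ ≤ S ^ 2 * e ^ 2 := mul_le_mul_of_nonneg_left h2 (sq_nonneg _)
    _ = (S * e) ^ 2 := by ring

/-- **Flux domination** `|ν · Φ| ≤ ‖ν‖ (‖u‖ + S₁ + S₂) e` of the cone-weighted relative-energy
method (finite domain of dependence for classical hard-sphere Euler solutions), in coordinates on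
`Fin 3`: here `e = ½ (A α² + r ∑ⱼ wⱼ² + B β²)` is the symmetrised energy and
`Φᵢ = ½ uᵢ (A α² + r ∑ⱼ wⱼ² + B β²) + P α wᵢ + R β wᵢ` the flux, with `P² ≤ S₁² A r`,
`R² ≤ S₂² B r`. -/
theorem flux_dot_le : ∀ (A r B P R S₁ S₂ al be : ℝ) (u w ν : Fin 3 → ℝ),
    0 ≤ A → 0 ≤ r → 0 ≤ B → 0 ≤ S₁ → 0 ≤ S₂ →
    P ^ 2 ≤ S₁ ^ 2 * (A * r) → R ^ 2 ≤ S₂ ^ 2 * (B * r) →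
    |∑ i, ν i * (1 / 2 * (A * u i * al ^ 2 + r * u i * (∑ j, w j ^ 2) + B * u i * be ^ 2) +
        P * al * w i + R * be * w i)| ≤
      Real.sqrt (∑ i, ν i ^ 2) * (Real.sqrt (∑ i, u i ^ 2) + S₁ + S₂) *
        (1 / 2 * (A * al ^ 2 + r * ∑ j, w j ^ 2 + B * be ^ 2)) := by
  intro A r B P R S₁ S₂ al be u w ν hA hr hB hS₁ hS₂ hP hR
  have hW0 : 0 ≤ ∑ j, w j ^ 2 := Finset.sum_nonneg fun j _ => sq_nonneg (w j)
  -- Cauchy–Schwarz on `Fin 3`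
  have hCSu : |∑ i, ν i * u i| ≤ Real.sqrt (∑ i, ν i ^ 2) * Real.sqrt (∑ i, u i ^ 2) :=
    abs_sum_mul_le_sqrt_mul_sqrt Finset.univ ν u
  have hCSw : |∑ i, ν i * w i| ≤ Real.sqrt (∑ i, ν i ^ 2) * Real.sqrt (∑ i, w i ^ 2) :=
    abs_sum_mul_le_sqrt_mul_sqrt Finset.univ ν w
  generalize ∑ j, w j ^ 2 = W at hW0 hCSw ⊢
  generalize he : 1 / 2 * (A * al ^ 2 + r * W + B * be ^ 2) = e
  have hx : 0 ≤ A * al ^ 2 := mul_nonneg hA (sq_nonneg _)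
  have hy : 0 ≤ r * W := mul_nonneg hr hW0
  have hz : 0 ≤ B * be ^ 2 := mul_nonneg hB (sq_nonneg _)
  have he0 : 0 ≤ e := by rw [← he]; linarith
  -- the flux dotted with `ν` splits as `e (ν · u) + (P α + R β) (ν · w)`
  have hsum : ∑ i, ν i * (1 / 2 * (A * u i * al ^ 2 + r * u i * W + B * u i * be ^ 2) +
      P * al * w i + R * be * w i) = e * ∑ i, ν i * u i + (P * al + R * be) * ∑ i, ν i * w i := by
    simp only [Fin.sum_univ_three, ← he]
    ring
  -- the mixed terms are dominated by `S₁ e` and `S₂ e`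
  have hPe : |P| * |al| * Real.sqrt W ≤ S₁ * e :=
    abs_mul_abs_mul_sqrt_le hS₁ hA hr hW0 hP (by rw [← he]; linarith)
  have hRe : |R| * |be| * Real.sqrt W ≤ S₂ * e :=
    abs_mul_abs_mul_sqrt_le hS₂ hB hr hW0 hR (by rw [← he]; linarith)
  have hn0 : 0 ≤ Real.sqrt (∑ i, ν i ^ 2) := Real.sqrt_nonneg _
  have hM0 : 0 ≤ |P| * |al| + |R| * |be| := by positivity
  have hPR : |P * al + R * be| ≤ |P| * |al| + |R| * |be| := by
    calc |P * al + R * be| ≤ |P * al| + |R * be| := abs_add_le _ _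
      _ = |P| * |al| + |R| * |be| := by rw [abs_mul, abs_mul]
  rw [hsum]
  calc |e * ∑ i, ν i * u i + (P * al + R * be) * ∑ i, ν i * w i|
      ≤ |e * ∑ i, ν i * u i| + |(P * al + R * be) * ∑ i, ν i * w i| := abs_add_le _ _
    _ = e * |∑ i, ν i * u i| + |P * al + R * be| * |∑ i, ν i * w i| := by
        rw [abs_mul, abs_mul, abs_of_nonneg he0]
    _ ≤ e * (Real.sqrt (∑ i, ν i ^ 2) * Real.sqrt (∑ i, u i ^ 2)) +
          (|P| * |al| + |R| * |be|) * (Real.sqrt (∑ i, ν i ^ 2) * Real.sqrt W) :=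
        add_le_add (mul_le_mul_of_nonneg_left hCSu he0)
          (mul_le_mul hPR hCSw (abs_nonneg _) hM0)
    _ = Real.sqrt (∑ i, ν i ^ 2) * (Real.sqrt (∑ i, u i ^ 2) * e) +
          Real.sqrt (∑ i, ν i ^ 2) * (|P| * |al| * Real.sqrt W + |R| * |be| * Real.sqrt W) := by
        ring
    _ ≤ Real.sqrt (∑ i, ν i ^ 2) * (Real.sqrt (∑ i, u i ^ 2) * e) +
          Real.sqrt (∑ i, ν i ^ 2) * (S₁ * e + S₂ * e) :=
        add_le_add le_rfl (mul_le_mul_of_nonneg_left (add_le_add hPe hRe) hn0)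
    _ = Real.sqrt (∑ i, ν i ^ 2) * (Real.sqrt (∑ i, u i ^ 2) + S₁ + S₂) * e := by ring

end

end Summit.AtomisticToContinuum.HydrodynamicLimit.Theorems.LightConeInLawSketch.DoD
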